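import Summits.AtomisticToContinuum.HydrodynamicLimit.Theorems.EnskogAdjointDualityDualityReductionFSide
import HarnessLib

/-!
# EnskogAdjointDuality / AdjointEnskogTestFamilyR — Maxwellian characteristic derivative,
# part 1: parametric calculus of the local Maxwellian

Support lemmas for the stub `stub_maxwellianCharDeriv` (B2) of the line `birth` of the crux
`Summit.AtomisticToContinuum.HydrodynamicLimit.Theses.EnskogAdjointDuality.AdjointEnskogTestFamilyR`
(stmt-AtomisticToContinuum-11592). The Euler local Maxwellian is `f = ρ M_{1,θ,u}` with
`M_{1,θ,u}(v) = (2πθ)^{-3/2} exp(-|v-u|²/(2θ))`; this file records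

* `k2r_localMaxwellian_eq` — the closed form on `ℝ³`;
* `k2r_contDiffOn_localMaxwellian_param` — joint smoothness of `(ρ', θ', u', v) ↦ ρ' M_{1,θ',u'}(v)`
  on `θ' > 0`;
* `k2r_hasDerivWithinAt_localMaxwellian_param` — the chain rule along a parameter curve
  `τ ↦ ρ̂(τ) M_{1,θ̂(τ),û(τ)}(v)`: derivative `M · [ρ̂' + ρ̂ (θ̂' (|v-û|²/(2θ̂²) − 3/(2θ̂)) + ⟪û', v-û⟫/θ̂)]`;
* `k2r_exists_pow_mul_localMaxwellian_le` — Gaussian beats polynomial: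
  `(1+|v|)^k M_{1,θ,u}(v) ≤ C(k, U, θm, Θ)` for `‖u‖ ≤ U`, `θm ≤ θ ≤ Θ`;
* `k2r_exists_pow_mul_charKernel_le` — the same for the characteristic-derivative kernel with
  coefficients of linear growth in `v`.

References: C. Cercignani, R. Illner, M. Pulvirenti, *The Mathematical Theory of Dilute Gases*
(1994), §3.3 [CIP1994]; H. Spohn, *Large Scale Dynamics of Interacting Particles* (1991), Part I §3.
-/

noncomputable section

open MeasureTheory Set Filter Topology
open scoped InnerProductSpace ContDiff

namespace Summit.AtomisticToContinuum.HydrodynamicLimit.Theorems.EnskogAdjointDuality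

open Literature.Analysis.FluidPDE Literature.MathematicalPhysics.KineticTheory

/-- The local Maxwellian on `ℝ³` in closed form:
`M_{1,θ,u}(v) = (2πθ)^{-3/2} exp(-|v-u|²/(2θ))`. [folklore] -/
theorem k2r_localMaxwellian_eq (θ : ℝ) (u v : V3) :
    localMaxwellian 1 θ u v =
      (2 * Real.pi * θ) ^ (-(3 : ℝ) / 2) * Real.exp (-‖v - u‖ ^ 2 / (2 * θ)) := by
  simp [localMaxwellian]

/-- Joint smoothness of `(ρ', θ', u', v) ↦ ρ' M_{1,θ',u'}(v)` on the half-space `θ' > 0`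
(positive base of the real power, polynomial exponent). [folklore] -/
theorem k2r_contDiffOn_localMaxwellian_param :
    ContDiffOn ℝ ∞ (fun p : ℝ × ℝ × V3 × V3 => p.1 * localMaxwellian 1 p.2.1 p.2.2.1 p.2.2.2)
      {p | 0 < p.2.1} := by
  have h : (fun p : ℝ × ℝ × V3 × V3 => p.1 * localMaxwellian 1 p.2.1 p.2.2.1 p.2.2.2) =
      fun p => p.1 * ((2 * Real.pi * p.2.1) ^ (-(3 : ℝ) / 2) *
        Real.exp (-‖p.2.2.2 - p.2.2.1‖ ^ 2 / (2 * p.2.1))) := by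
    funext p; rw [k2r_localMaxwellian_eq]
  rw [h]
  refine contDiffOn_fst.mul (ContDiffOn.mul ?_ ?_)
  · refine ContDiffOn.rpow_const_of_ne (by fun_prop) fun p hp => ?_
    have : (0 : ℝ) < p.2.1 := hp
    positivity
  · refine ContDiffOn.exp (ContDiffOn.div ?_ (by fun_prop) fun p hp => ?_)
    · exact (ContDiffOn.norm_sq ℝ (by fun_prop)).neg
    · have : (0 : ℝ) < p.2.1 := hp
      positivity

/-- **Chain rule along a parameter curve.** If `ρ̂, θ̂, û` have derivatives `ρ', θ', u'` at `τ`
within `s` and `θ̂ τ > 0`, then `r ↦ ρ̂ r · M_{1,θ̂ r,û r}(v)` has derivative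
`M_{1,θ̂ τ,û τ}(v) · [ρ' + ρ̂ τ (θ' (|v-û τ|²/(2 θ̂ τ²) − 3/(2 θ̂ τ)) + ⟪u', v − û τ⟫/θ̂ τ)]` at `τ`
within `s`. [cite: CIP1994, §3.3] -/
theorem k2r_hasDerivWithinAt_localMaxwellian_param {ρh θh : ℝ → ℝ} {uh : ℝ → V3}
    {ρ' θ' : ℝ} {u' : V3} {τ : ℝ} {s : Set ℝ}
    (hρ : HasDerivWithinAt ρh ρ' s τ) (hθ : HasDerivWithinAt θh θ' s τ)
    (hu : HasDerivWithinAt uh u' s τ) (hpos : 0 < θh τ) (v : V3) :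
    HasDerivWithinAt (fun r => ρh r * localMaxwellian 1 (θh r) (uh r) v)
      (localMaxwellian 1 (θh τ) (uh τ) v *
        (ρ' + ρh τ * (θ' * (‖v - uh τ‖ ^ 2 / (2 * θh τ ^ 2) - 3 / (2 * θh τ)) +
          ⟪u', v - uh τ⟫_ℝ / θh τ))) s τ := by
  have hfun : (fun r => ρh r * localMaxwellian 1 (θh r) (uh r) v) =
      fun r => ρh r * ((2 * Real.pi * θh r) ^ (-(3 : ℝ) / 2) *
        Real.exp (-‖v - uh r‖ ^ 2 / (2 * θh r))) := by
    funext r; rw [k2r_localMaxwellian_eq]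
  rw [hfun, k2r_localMaxwellian_eq]
  have h2πθ : (0 : ℝ) < 2 * Real.pi * θh τ := by positivity
  -- the power
  have hA : HasDerivWithinAt (fun r => (2 * Real.pi * θh r) ^ (-(3 : ℝ) / 2))
      (2 * Real.pi * θ' * (-(3 : ℝ) / 2) * (2 * Real.pi * θh τ) ^ (-(3 : ℝ) / 2 - 1)) s τ :=
    (hθ.const_mul (2 * Real.pi)).rpow_const (Or.inl h2πθ.ne')
  -- the exponent
  have hN : HasDerivWithinAt (fun r => ‖v - uh r‖ ^ 2) (2 * ⟪v - uh τ, -u'⟫_ℝ) s τ :=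
    (hu.const_sub v).norm_sq
  have hE : HasDerivWithinAt (fun r => -‖v - uh r‖ ^ 2 / (2 * θh r))
      ((-(2 * ⟪v - uh τ, -u'⟫_ℝ) * (2 * θh τ) - -‖v - uh τ‖ ^ 2 * (2 * θ')) / (2 * θh τ) ^ 2)
      s τ :=
    hN.neg.div (hθ.const_mul 2) (by positivity)
  have hB := hE.exp
  have hprod : HasDerivWithinAt (fun r => ρh r * ((2 * Real.pi * θh r) ^ (-(3 : ℝ) / 2) *
      Real.exp (-‖v - uh r‖ ^ 2 / (2 * θh r)))) _ s τ := hρ.mul (hA.mul hB)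
  refine hprod.congr_deriv ?_
  have hθ0 : θh τ ≠ 0 := hpos.ne'
  have hsub : (2 * Real.pi * θh τ) ^ (-(3 : ℝ) / 2 - 1) =
      (2 * Real.pi * θh τ) ^ (-(3 : ℝ) / 2) / (2 * Real.pi * θh τ) := by
    rw [Real.rpow_sub_one h2πθ.ne']
  rw [hsub, inner_neg_right, real_inner_comm]
  field_simp
  ring

/-- The chain rule along a parameter curve, two-sided version. [cite: CIP1994, §3.3] -/
theorem k2r_hasDerivAt_localMaxwellian_param {ρh θh : ℝ → ℝ} {uh : ℝ → V3}
    {ρ' θ' : ℝ} {u' : V3} {τ : ℝ}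
    (hρ : HasDerivAt ρh ρ' τ) (hθ : HasDerivAt θh θ' τ) (hu : HasDerivAt uh u' τ)
    (hpos : 0 < θh τ) (v : V3) :
    HasDerivAt (fun r => ρh r * localMaxwellian 1 (θh r) (uh r) v)
      (localMaxwellian 1 (θh τ) (uh τ) v *
        (ρ' + ρh τ * (θ' * (‖v - uh τ‖ ^ 2 / (2 * θh τ ^ 2) - 3 / (2 * θh τ)) +
          ⟪u', v - uh τ⟫_ℝ / θh τ))) τ := by
  rw [← hasDerivWithinAt_univ] at *
  exact k2r_hasDerivWithinAt_localMaxwellian_param hρ hθ hu hpos v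

/-- Elementary: `(1 + x)^k e^{-x} ≤ k! · e` for `x ≥ 0` (from `yᵏ/k! ≤ eʸ` at `y = 1 + x`).
[folklore] -/
theorem k2r_one_add_pow_mul_exp_neg_le (k : ℕ) {x : ℝ} (hx : 0 ≤ x) :
    (1 + x) ^ k * Real.exp (-x) ≤ k.factorial * Real.exp 1 := by
  have h := Real.pow_div_factorial_le_exp (1 + x) (by positivity) k
  rw [div_le_iff₀ (by positivity), Real.exp_add] at h
  calc (1 + x) ^ k * Real.exp (-x)
      ≤ (Real.exp 1 * Real.exp x * k.factorial) * Real.exp (-x) := by gcongr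
    _ = k.factorial * Real.exp 1 := by
        rw [Real.exp_neg]
        field_simp

/-- **Gaussian beats polynomial.** For `‖u‖ ≤ U` and `θm ≤ θ ≤ Θ` (`θm > 0`),
`(1 + |v|)^k M_{1,θ,u}(v) ≤ C(k, U, θm, Θ)` uniformly in `v`. [folklore] -/
theorem k2r_exists_pow_mul_localMaxwellian_le (k : ℕ) (U θm Θ : ℝ) (hθm : 0 < θm) :
    ∃ C : ℝ, 0 ≤ C ∧ ∀ (θ : ℝ) (u v : V3), θm ≤ θ → θ ≤ Θ → ‖u‖ ≤ U →
      (1 + ‖v‖) ^ k * localMaxwellian 1 θ u v ≤ C := by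
  set A : ℝ := (2 * Real.pi * θm) ^ (-(3 : ℝ) / 2) with hA
  have hA0 : 0 ≤ A := Real.rpow_nonneg (by positivity) _
  refine ⟨((1 + |U|) * (2 * (1 + 2 * |Θ|))) ^ k * (k.factorial * Real.exp 1) * A,
    by positivity, ?_⟩
  intro θ u v hθm' hθΘ hu
  have hθ : 0 < θ := hθm.trans_le hθm'
  have hΘ : 0 < Θ := hθ.trans_le hθΘ
  set r : ℝ := ‖v - u‖ with hr
  have hr0 : 0 ≤ r := norm_nonneg _
  set x : ℝ := r ^ 2 / (2 * Θ) with hx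
  have hx0 : 0 ≤ x := by positivity
  -- the Maxwellian against the widest Gaussian
  have hM : localMaxwellian 1 θ u v ≤ A * Real.exp (-x) := by
    rw [k2r_localMaxwellian_eq]
    refine mul_le_mul ?_ ?_ (Real.exp_nonneg _) hA0
    · exact Real.rpow_le_rpow_of_nonpos (by positivity) (by nlinarith [Real.pi_pos]) (by norm_num)
    · rw [Real.exp_le_exp, hx, neg_div, neg_le_neg_iff]
      exact div_le_div_of_nonneg_left (sq_nonneg _) (by positivity) (by linarith)
  -- the polynomial weight against `1 + x`
  have h1 : 1 + ‖v‖ ≤ (1 + |U|) * (2 * (1 + 2 * |Θ|)) * (1 + x) := by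
    have hvu : ‖v‖ ≤ |U| + r := by
      calc ‖v‖ = ‖(v - u) + u‖ := by rw [sub_add_cancel]
        _ ≤ ‖v - u‖ + ‖u‖ := norm_add_le _ _
        _ ≤ r + |U| := by rw [hr]; gcongr; exact hu.trans (le_abs_self U)
        _ = |U| + r := add_comm _ _
    have h2 : 1 + r ≤ 2 * (1 + r ^ 2) := by nlinarith [sq_nonneg (r - 1)]
    have h3 : 1 + r ^ 2 ≤ (1 + 2 * |Θ|) * (1 + x) := by
      have hr2 : r ^ 2 = 2 * Θ * x := by
        rw [hx]; field_simp
      rw [hr2, abs_of_pos hΘ]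
      nlinarith [mul_nonneg hΘ.le hx0]
    have hU0 : 0 ≤ |U| := abs_nonneg U
    calc 1 + ‖v‖ ≤ 1 + (|U| + r) := by linarith
      _ ≤ (1 + |U|) * (1 + r) := by nlinarith [mul_nonneg hU0 hr0]
      _ ≤ (1 + |U|) * (2 * (1 + r ^ 2)) := by gcongr
      _ ≤ (1 + |U|) * (2 * ((1 + 2 * |Θ|) * (1 + x))) := by gcongr
      _ = (1 + |U|) * (2 * (1 + 2 * |Θ|)) * (1 + x) := by ring
  have hk : (1 + ‖v‖) ^ k ≤ ((1 + |U|) * (2 * (1 + 2 * |Θ|))) ^ k * (1 + x) ^ k := by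
    rw [← mul_pow]
    exact pow_le_pow_left₀ (by positivity) h1 k
  have hM0 : 0 ≤ localMaxwellian 1 θ u v := localMaxwellian_nonneg zero_le_one hθ.le u v
  calc (1 + ‖v‖) ^ k * localMaxwellian 1 θ u v
      ≤ (((1 + |U|) * (2 * (1 + 2 * |Θ|))) ^ k * (1 + x) ^ k) * (A * Real.exp (-x)) :=
        mul_le_mul hk hM hM0 (by positivity)
    _ = ((1 + |U|) * (2 * (1 + 2 * |Θ|))) ^ k * ((1 + x) ^ k * Real.exp (-x)) * A := by ring
    _ ≤ ((1 + |U|) * (2 * (1 + 2 * |Θ|))) ^ k * (k.factorial * Real.exp 1) * A :=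
        mul_le_mul_of_nonneg_right (mul_le_mul_of_nonneg_left
          (k2r_one_add_pow_mul_exp_neg_le k hx0) (by positivity)) hA0

/-- **Decay of the characteristic-derivative kernel.** For parameters in a compact range
(`|ρ'| ≤ R`, `θm ≤ θ' ≤ Θ`, `‖u'‖ ≤ U`) and coefficients of linear growth
(`|δρ|, |δθ|, ‖δu‖ ≤ B(1+|v|)`), the kernel
`M_{1,θ',u'}(v) [δρ + ρ'(δθ (|v-u'|²/(2θ'²) − 3/(2θ')) + ⟪δu, v-u'⟫/θ')]` times `(1+|v|)^k` is
bounded uniformly in `v`. [folklore] -/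
theorem k2r_exists_pow_mul_charKernel_le (k : ℕ) (R U θm Θ B : ℝ) (hθm : 0 < θm) :
    ∃ C : ℝ, 0 ≤ C ∧ ∀ (ρ' θ' δρ δθ : ℝ) (u' δu v : V3), |ρ'| ≤ R → θm ≤ θ' → θ' ≤ Θ →
      ‖u'‖ ≤ U → |δρ| ≤ B * (1 + ‖v‖) → |δθ| ≤ B * (1 + ‖v‖) → ‖δu‖ ≤ B * (1 + ‖v‖) →
      (1 + ‖v‖) ^ k * |localMaxwellian 1 θ' u' v *
        (δρ + ρ' * (δθ * (‖v - u'‖ ^ 2 / (2 * θ' ^ 2) - 3 / (2 * θ')) +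
          ⟪δu, v - u'⟫_ℝ / θ'))| ≤ C := by
  obtain ⟨C₀, hC₀0, hC₀⟩ := k2r_exists_pow_mul_localMaxwellian_le (k + 3) U θm Θ hθm
  -- the constant in `|bracket| ≤ L (1+|v|)³`
  set L : ℝ := |B| * (1 + |R| * ((1 + |U|) ^ 2 / (2 * θm ^ 2) + 3 / (2 * θm) + (1 + |U|) / θm))
    with hL
  have hL0 : 0 ≤ L := by positivity
  refine ⟨L * C₀, by positivity, ?_⟩
  intro ρ' θ' δρ δθ u' δu v hρ hθm' hθΘ hu hδρ hδθ hδu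
  have hθ : 0 < θ' := hθm.trans_le hθm'
  set n : ℝ := 1 + ‖v‖ with hn
  have hn1 : 1 ≤ n := by rw [hn]; linarith [norm_nonneg v]
  have hn0 : 0 ≤ n := zero_le_one.trans hn1
  have hB : B ≤ |B| := le_abs_self B
  have hvu : ‖v - u'‖ ≤ (1 + |U|) * n := by
    calc ‖v - u'‖ ≤ ‖v‖ + ‖u'‖ := norm_sub_le _ _
      _ ≤ ‖v‖ + |U| := by linarith [le_abs_self U]
      _ ≤ (1 + |U|) * n := by rw [hn]; nlinarith [abs_nonneg U, norm_nonneg v]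
  -- bound of the bracket
  have hbr : |δρ + ρ' * (δθ * (‖v - u'‖ ^ 2 / (2 * θ' ^ 2) - 3 / (2 * θ')) +
      ⟪δu, v - u'⟫_ℝ / θ')| ≤ L * n ^ 3 := by
    have hδρ' : |δρ| ≤ |B| * n := hδρ.trans (by gcongr)
    have hδθ' : |δθ| ≤ |B| * n := hδθ.trans (by gcongr)
    have hδu' : ‖δu‖ ≤ |B| * n := hδu.trans (by gcongr)
    have hρR : |ρ'| ≤ |R| := hρ.trans (le_abs_self R)
    have hsq : ‖v - u'‖ ^ 2 / (2 * θ' ^ 2) ≤ (1 + |U|) ^ 2 / (2 * θm ^ 2) * n ^ 2 := by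
      rw [div_mul_eq_mul_div, ← mul_pow]
      exact div_le_div₀ (by positivity) (pow_le_pow_left₀ (norm_nonneg _) hvu 2) (by positivity)
        (by gcongr)
    have h32 : 3 / (2 * θ') ≤ 3 / (2 * θm) * n ^ 2 := by
      calc 3 / (2 * θ') ≤ 3 / (2 * θm) := by gcongr
        _ ≤ 3 / (2 * θm) * n ^ 2 := le_mul_of_one_le_right (by positivity) (one_le_pow₀ hn1)
    have hin : |⟪δu, v - u'⟫_ℝ / θ'| ≤ |B| * n * ((1 + |U|) / θm * n) := by
      rw [abs_div, abs_of_pos hθ]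
      calc |⟪δu, v - u'⟫_ℝ| / θ' ≤ ‖δu‖ * ‖v - u'‖ / θ' := by
            gcongr; exact abs_real_inner_le_norm _ _
        _ ≤ (|B| * n) * ((1 + |U|) * n) / θm := by gcongr
        _ = |B| * n * ((1 + |U|) / θm * n) := by ring
    have hmid : |δθ * (‖v - u'‖ ^ 2 / (2 * θ' ^ 2) - 3 / (2 * θ'))| ≤
        |B| * n * (((1 + |U|) ^ 2 / (2 * θm ^ 2) + 3 / (2 * θm)) * n ^ 2) := by
      rw [abs_mul]
      refine mul_le_mul hδθ' ?_ (abs_nonneg _) (by positivity)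
      rw [add_mul]
      exact (abs_sub _ _).trans (add_le_add (by rwa [abs_of_nonneg (by positivity)])
        (by rwa [abs_of_nonneg (by positivity)]))
    calc |δρ + ρ' * (δθ * (‖v - u'‖ ^ 2 / (2 * θ' ^ 2) - 3 / (2 * θ')) + ⟪δu, v - u'⟫_ℝ / θ')|
        ≤ |δρ| + |ρ'| * (|δθ * (‖v - u'‖ ^ 2 / (2 * θ' ^ 2) - 3 / (2 * θ'))| +
            |⟪δu, v - u'⟫_ℝ / θ'|) := by
          refine (abs_add_le _ _).trans ?_
          gcongr
          rw [abs_mul]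
          exact mul_le_mul_of_nonneg_left (abs_add_le _ _) (abs_nonneg _)
      _ ≤ |B| * n + |R| * (|B| * n * (((1 + |U|) ^ 2 / (2 * θm ^ 2) + 3 / (2 * θm)) * n ^ 2) +
            |B| * n * ((1 + |U|) / θm * n)) := by
          gcongr
      _ ≤ L * n ^ 3 := by
          rw [hL]
          have hn2 : n ≤ n ^ 3 := by nlinarith [one_le_pow₀ (n := 2) hn1]
          have hn3 : n * n ≤ n ^ 3 := by nlinarith
          set P : ℝ := (1 + |U|) ^ 2 / (2 * θm ^ 2) + 3 / (2 * θm) with hP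
          set Q : ℝ := (1 + |U|) / θm with hQ
          have hQ0 : 0 ≤ Q := by positivity
          have t1 : |B| * n ≤ |B| * n ^ 3 := by gcongr
          have t3 : |B| * n * (Q * n) ≤ |B| * n ^ 3 * Q := by
            rw [show |B| * n * (Q * n) = |B| * (n * n) * Q by ring]
            gcongr
          have t3' := mul_le_mul_of_nonneg_left t3 (abs_nonneg R)
          have e1 : |B| * n + |R| * (|B| * n * (P * n ^ 2) + |B| * n * (Q * n)) =
              |B| * n + |R| * (|B| * n ^ 3 * P) + |R| * (|B| * n * (Q * n)) := by ring
          have e2 : |B| * (1 + |R| * (P + Q)) * n ^ 3 =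
              |B| * n ^ 3 + |R| * (|B| * n ^ 3 * P) + |R| * (|B| * n ^ 3 * Q) := by ring
          rw [e1, e2]
          linarith [t1, t3']
  have hM0 : 0 ≤ localMaxwellian 1 θ' u' v := localMaxwellian_nonneg zero_le_one hθ.le u' v
  calc n ^ k * |localMaxwellian 1 θ' u' v * (δρ + ρ' * (δθ * (‖v - u'‖ ^ 2 / (2 * θ' ^ 2) -
        3 / (2 * θ')) + ⟪δu, v - u'⟫_ℝ / θ'))|
      = n ^ k * localMaxwellian 1 θ' u' v * |δρ + ρ' * (δθ * (‖v - u'‖ ^ 2 / (2 * θ' ^ 2) -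
        3 / (2 * θ')) + ⟪δu, v - u'⟫_ℝ / θ')| := by rw [abs_mul, abs_of_nonneg hM0, mul_assoc]
    _ ≤ n ^ k * localMaxwellian 1 θ' u' v * (L * n ^ 3) := by gcongr
    _ = L * (n ^ (k + 3) * localMaxwellian 1 θ' u' v) := by ring
    _ ≤ L * C₀ := by gcongr; exact hC₀ θ' u' v hθm' hθΘ hu

/-- **Registered form (sub-goal `stub_maxwellianCharDeriv_param` of stub B2).** Decay of the
characteristic-derivative kernel of the local Maxwellian, uniformly on a compact parameter range:
`(1+|v|)^k |M_{1,θ',u'}(v) [δρ + ρ'(δθ (|v-u'|²/(2θ'²) − 3/(2θ')) + ⟪δu, v-u'⟫/θ')]| ≤ C` for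
`|ρ'| ≤ R`, `θm ≤ θ' ≤ Θ`, `‖u'‖ ≤ U` and coefficients `|δρ|, |δθ|, ‖δu‖ ≤ B(1+|v|)`.
[cite: CIP1994, §3.3] -/
theorem stub_maxwellianCharDeriv_param :
    ∀ (k : ℕ) (R U θm Θ B : ℝ), 0 < θm → ∃ C : ℝ, 0 ≤ C ∧
      ∀ (ρ' θ' δρ δθ : ℝ) (u' δu v : EuclideanSpace ℝ (Fin 3)), |ρ'| ≤ R → θm ≤ θ' → θ' ≤ Θ →
      ‖u'‖ ≤ U → |δρ| ≤ B * (1 + ‖v‖) → |δθ| ≤ B * (1 + ‖v‖) → ‖δu‖ ≤ B * (1 + ‖v‖) →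
      (1 + ‖v‖) ^ k * |Literature.Analysis.FluidPDE.localMaxwellian 1 θ' u' v *
        (δρ + ρ' * (δθ * (‖v - u'‖ ^ 2 / (2 * θ' ^ 2) - 3 / (2 * θ')) +
          inner ℝ δu (v - u') / θ'))| ≤ C :=
  k2r_exists_pow_mul_charKernel_le

end Summit.AtomisticToContinuum.HydrodynamicLimit.Theorems.EnskogAdjointDuality

end
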